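import Summits.CriticalPhenomena.Ising3D.Control2DVertexSectors
import Summits.CriticalPhenomena.Ising3D.Control2DOpeTwoSided
import Mathlib.Tactic
import HarnessLib

/-!
# The free-boson vertex-operator witness, VI: the datum `vertexData2D s` — blocks, unitarity, crossing,
spectrum, and the Ward value `p_T = s²/2` at `c = 1`
(cell `pub-ising3x`, seat controls-1 gen 36; NON-VACUITY of the 2D control's hypothesis classes WITH a
stress tensor, step 6 of 7 — CONTROL-ONLY)

HONEST FRAMING: lottery ticket; floor = tightest certified 3D Ising CFT bounds; no exact-solution
claim without a proof. CONTROL-ONLY (`d = 2`, `Δ_σ = s`; the witness is the free boson at `c = 1`,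
NOT the 2D Ising CFT); nothing numerical is asserted here.

* `vertexData2D s : CrossingData` — labels: the `U(1)`-current (identity) family `(n, m)`, `n ≥ m`,
  `n + m` even, `(n,m) ≠ (0,0)`, at `(h, h̄) = (n, m)` (`Δ = n + m`, `ℓ = n - m`, `p = α'_n α'_m` for `n > m`,
  `α'_n²/2` for `n = m`); the charge-`2α` family `(k, l)`, `k ≥ l`, at `(h, h̄) = (2s+2k, 2s+2l)`
  (`Δ = 4s+2k+2l`, `ℓ = 2(k-l)`, `p = γ_k γ_l/2` resp. `γ_k²/4`) — ONE label per quasi-primary location;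
* `hasSum_vertexData2D_blocks` — **`Σ_i p_i g_{Δ_i,ℓ_i}(z,z̄) = 𝒢(z,z̄) - 1`** on the open square;
  `vertexData2D_isUnitary`; `vertexData2D_satisfiesCrossing` — the sum rule at `Δ_σ = s` in the tree's
  conventions (`v^s(𝒢-1)(z,z̄) - u^s(𝒢-1)(1-z,1-z̄) = u^s - v^s = -F_-[1]`);
* the spectrum: `vertexData2D_scalarsIn` (`⊆ {4s} ∪ [2,∞)`), `vertexData2D_hasScalarGap` (`min(4s,2)`),
  `vertexData2D_spinTwoIn` (`⊆ {2} ∪ [2 + min(2,4s), ∞)`: the stress tensor IS present), and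
  **`vertexData2D_stressCoeff : stressCoeff = s²/2 = Δ_O²/(2c)`, `c = 1`** — the Ward normalisation that
  `CTwoSided` (`Control2DOpeTwoSided`) takes as a hypothesis, realised by a datum in the tree's normalisation
  `g_T = k_4(z) + k_4(z̄)`.

Consequences for the control's typed statements are drawn in `Control2DVertexNonVacuity`.

References: Ph. Di Francesco, P. Mathieu, D. Sénéchal, Conformal Field Theory (Springer 1997), §9.1
[cite: DiFrancescoMathieuSenechal1997, §9.1]; R. Rattazzi, V. S. Rychkov, E. Tonni, A. Vichi, JHEP 12
(2008) 031, §3 eq. (3.6) [cite: RattazziEtAl2008, §3 eq. (3.6)]; A. A. Belavin, A. M. Polyakov,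
A. B. Zamolodchikov, Nucl. Phys. B 241 (1984) 333, §3 [cite: BelavinPolyakovZamolodchikov1984, §3];
F. A. Dolan, H. Osborn, Nucl. Phys. B 678 (2004) 491, §3 [cite: DolanOsborn2004, §3]. Tree: `CrossingData`,
`globalBlock`, `crossF` (`Control2DBootstrap`), `ScalarsIn`, `SpinTwoIn` (`Control2DIsland`), `stressSet`,
`stressCoeff` (`Control2DOpeTwoSided`), `foldPairs`, `vtxIdDouble`, `vtxChDouble` (`Control2DVertexSectors`).
-/

namespace Summit.CriticalPhenomena.Ising3D.Control2D

open Finset Set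
open Literature.MathematicalPhysics.QuantumFieldTheory.ConformalBootstrap3D

section Data

variable {s z zb : ℝ}

/-! ### The witness as a `CrossingData` -/

/-- Identity-sector labels: `(n, m)` with `m ≤ n`, `n + m` even, `(n, m) ≠ (0, 0)`. [folklore] -/
abbrev VtxIdLabel : Type := {nm : ℕ × ℕ // nm.2 ≤ nm.1 ∧ Even (nm.1 + nm.2) ∧ nm ≠ (0, 0)}

/-- Charge-sector labels: `(k, l)` with `l ≤ k`. [folklore] -/
abbrev VtxChLabel : Type := {kl : ℕ × ℕ // kl.2 ≤ kl.1}

/-- **The free-boson vertex four-point function as a `CrossingData`** (`O = √2 cos(αφ)`, `Δ_O = s`):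
identity family `(h,h̄) = (n,m)` with `p = α'_n α'_m` (`n > m`) / `α_n²/2` (`n = m`); charge-`2α` family
`(h,h̄) = (2s+2k, 2s+2l)` with `p = γ_k γ_l/2` (`k > l`) / `γ_k²/4` (`k = l`). Each quasi-primary location is
ONE label. [cite: DiFrancescoMathieuSenechal1997, §9.1] -/
noncomputable def vertexData2D (s : ℝ) : CrossingData where
  ι := VtxIdLabel ⊕ VtxChLabel
  Δ := fun i => match i with
    | Sum.inl a => (a.1.1 : ℝ) + a.1.2
    | Sum.inr b => 4 * s + 2 * b.1.1 + 2 * b.1.2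
  spin := fun i => match i with
    | Sum.inl a => a.1.1 - a.1.2
    | Sum.inr b => 2 * (b.1.1 - b.1.2)
  p := fun i => match i with
    | Sum.inl a => if a.1.2 < a.1.1 then vtxAlpha' s a.1.1 * vtxAlpha' s a.1.2
        else vtxAlpha' s a.1.1 ^ 2 / 2
    | Sum.inr b => if b.1.2 < b.1.1 then vtxGamma b.1.1 s * vtxGamma b.1.2 s / 2
        else vtxGamma b.1.1 s ^ 2 / 4

/-- The block of an identity-sector label: `g_{n+m, n-m} = k_{2n}(z) k_{2m}(z̄) + k_{2m}(z) k_{2n}(z̄)`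
(`m ≤ n`). [cite: DolanOsborn2004, §3] -/
theorem globalBlock_vtxId {n m : ℕ} (h : m ≤ n) (z zb : ℝ) :
    globalBlock ((n : ℝ) + m) (n - m) z zb =
      chiralBlock n z * chiralBlock m zb + chiralBlock m z * chiralBlock n zb := by
  unfold globalBlock
  rw [Nat.cast_sub h, show (((n : ℝ) + m) + ((n : ℝ) - m)) / 2 = n by ring,
    show (((n : ℝ) + m) - ((n : ℝ) - m)) / 2 = m by ring]

/-- The block of a charge-sector label: `g = K_k(z) K_l(z̄) + K_l(z) K_k(z̄)`, `K_k = k_{4s+4k}` (`l ≤ k`).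
[cite: DolanOsborn2004, §3] -/
theorem globalBlock_vtxCh (s : ℝ) {k l : ℕ} (h : l ≤ k) (z zb : ℝ) :
    globalBlock (4 * s + 2 * k + 2 * l) (2 * (k - l)) z zb =
      chiralBlock (2 * s + 2 * k) z * chiralBlock (2 * s + 2 * l) zb +
        chiralBlock (2 * s + 2 * l) z * chiralBlock (2 * s + 2 * k) zb := by
  unfold globalBlock
  push_cast
  rw [Nat.cast_sub h, show ((4 * s + 2 * (k : ℝ) + 2 * l) + 2 * ((k : ℝ) - l)) / 2 = 2 * s + 2 * k by ring,
    show ((4 * s + 2 * (k : ℝ) + 2 * l) - 2 * ((k : ℝ) - l)) / 2 = 2 * s + 2 * l by ring]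

/-- The identity-sector part of `Σ p_i g_i`: the folded family equals `p · g` on the labels and vanishes
elsewhere. [folklore] -/
theorem foldPairs_vtxId (s z zb : ℝ) (nm : ℕ × ℕ) :
    foldPairs (vtxIdDouble s z zb) nm =
      if h : nm.2 ≤ nm.1 ∧ Even (nm.1 + nm.2) ∧ nm ≠ (0, 0) then
        (vertexData2D s).p (Sum.inl ⟨nm, h⟩) *
          globalBlock ((vertexData2D s).Δ (Sum.inl ⟨nm, h⟩)) ((vertexData2D s).spin (Sum.inl ⟨nm, h⟩)) z zb
      else 0 := by
  obtain ⟨n, m⟩ := nm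
  simp only [foldPairs, vtxIdDouble, vertexData2D, Prod.swap_prod_mk]
  by_cases hlt : m < n
  · have hne : ((n, m) : ℕ × ℕ) ≠ (0, 0) := by
      intro h; simp only [Prod.mk.injEq] at h; omega
    have hne' : ((m, n) : ℕ × ℕ) ≠ (0, 0) := by
      intro h; simp only [Prod.mk.injEq] at h; omega
    by_cases he : Even (n + m)
    · have he' : Even (m + n) := by rwa [add_comm]
      rw [if_pos hlt, if_pos ⟨he, hne⟩, if_pos ⟨he', hne'⟩, dif_pos ⟨hlt.le, he, hne⟩]
      simp only [if_pos hlt]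
      rw [globalBlock_vtxId hlt.le]
      ring
    · have he' : ¬ Even (m + n) := by rwa [add_comm]
      rw [if_pos hlt, if_neg (fun h => he h.1), if_neg (fun h => he' h.1), dif_neg (fun h => he h.2.1)]
      simp
  · by_cases heq : m = n
    · subst heq
      rw [if_neg hlt, if_pos rfl]
      by_cases h0 : ((m, m) : ℕ × ℕ) = (0, 0)
      · rw [if_neg (fun h => h.2 h0), dif_neg (fun h => h.2.2 h0)]
      · have he : Even (m + m) := ⟨m, rfl⟩
        rw [if_pos ⟨he, h0⟩, dif_pos ⟨le_rfl, he, h0⟩]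
        simp only [lt_irrefl, if_false]
        rw [globalBlock_vtxId le_rfl]
        ring
    · rw [if_neg hlt, if_neg heq, dif_neg (fun h => by omega)]

/-- The charge-sector part: the folded family equals `p · g` on the labels. [folklore] -/
theorem foldPairs_vtxCh (s z zb : ℝ) (kl : ℕ × ℕ) :
    foldPairs (vtxChDouble s z zb) kl =
      if h : kl.2 ≤ kl.1 then
        (vertexData2D s).p (Sum.inr ⟨kl, h⟩) *
          globalBlock ((vertexData2D s).Δ (Sum.inr ⟨kl, h⟩)) ((vertexData2D s).spin (Sum.inr ⟨kl, h⟩)) z zb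
      else 0 := by
  obtain ⟨k, l⟩ := kl
  simp only [foldPairs, vtxChDouble, vertexData2D, Prod.swap_prod_mk]
  by_cases hlt : l < k
  · rw [if_pos hlt, dif_pos hlt.le]
    simp only [if_pos hlt]
    rw [globalBlock_vtxCh s hlt.le]
    ring
  · by_cases heq : l = k
    · subst heq
      rw [if_neg hlt, if_pos rfl, dif_pos le_rfl]
      simp only [lt_irrefl, if_false]
      rw [globalBlock_vtxCh s le_rfl]
      ring
    · rw [if_neg hlt, if_neg heq, dif_neg (by omega)]

/-- **Block expansion of the free-boson vertex four-point function**: for `s > 0` and `(z, z̄)` in the open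
square, `Σ_i p_i g_{Δ_i,ℓ_i}(z,z̄) = ½((1-z)^{-s}(1-z̄)^{-s} + (1-z)^{s}(1-z̄)^{s}) - 1 + ½ (z^{2s}/(1-z)^s)(z̄^{2s}/(1-z̄)^s)`
`= 𝒢(z,z̄) - 1`. [cite: DiFrancescoMathieuSenechal1997, §9.1] -/
theorem hasSum_vertexData2D_blocks (hs : 0 < s) (hz : z ∈ Ioo (0 : ℝ) 1) (hzb : zb ∈ Ioo (0 : ℝ) 1) :
    HasSum (fun i : (vertexData2D s).ι =>
        (vertexData2D s).p i * globalBlock ((vertexData2D s).Δ i) ((vertexData2D s).spin i) z zb)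
      ((((1 - z) ^ (-s) * (1 - zb) ^ (-s) + (1 - z) ^ s * (1 - zb) ^ s) / 2 - 1) +
        (z ^ (2 * s) / (1 - z) ^ s) * (zb ^ (2 * s) / (1 - zb) ^ s) / 2) := by
  have hI := hasSum_foldPairs (vtxIdDouble_nonneg hs.le hz hzb) (hasSum_vtxIdDouble hs.le hz hzb)
  have hC := hasSum_foldPairs (vtxChDouble_nonneg hs hz hzb) (hasSum_vtxChDouble hs hz hzb)
  -- restrict to the label subtypes
  have hIsupp : Function.support (foldPairs (vtxIdDouble s z zb)) ⊆
      {nm : ℕ × ℕ | nm.2 ≤ nm.1 ∧ Even (nm.1 + nm.2) ∧ nm ≠ (0, 0)} := by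
    intro nm hnm
    by_contra h
    rw [Set.mem_setOf_eq] at h
    exact hnm (by rw [foldPairs_vtxId, dif_neg h])
  have hCsupp : Function.support (foldPairs (vtxChDouble s z zb)) ⊆ {kl : ℕ × ℕ | kl.2 ≤ kl.1} := by
    intro kl hkl
    by_contra h
    rw [Set.mem_setOf_eq] at h
    exact hkl (by rw [foldPairs_vtxCh, dif_neg h])
  have hI' := (hasSum_subtype_iff_of_support_subset hIsupp).2 hI
  have hC' := (hasSum_subtype_iff_of_support_subset hCsupp).2 hC
  refine HasSum.sum ?_ ?_
  · refine hI'.congr_fun fun a => ?_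
    obtain ⟨nm, h⟩ := a
    have h' : nm.2 ≤ nm.1 ∧ Even (nm.1 + nm.2) ∧ nm ≠ (0, 0) := h
    show _ = foldPairs (vtxIdDouble s z zb) nm
    simp only [Function.comp_apply]
    rw [foldPairs_vtxId, dif_pos h']
    rfl
  · refine hC'.congr_fun fun b => ?_
    obtain ⟨kl, h⟩ := b
    have h' : kl.2 ≤ kl.1 := h
    show _ = foldPairs (vtxChDouble s z zb) kl
    simp only [Function.comp_apply]
    rw [foldPairs_vtxCh, dif_pos h']
    rfl

/-- **Unitarity of the witness** (`s > 0`): even spins, `Δ ≥ ℓ`, `p ≥ 0`. [folklore] -/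
theorem vertexData2D_isUnitary (hs : 0 < s) : (vertexData2D s).IsUnitary := by
  rintro (⟨⟨n, m⟩, hle, he, hne⟩ | ⟨⟨k, l⟩, hle⟩)
  · refine ⟨?_, ?_, ?_⟩
    · show Even (n - m)
      rw [Nat.even_sub hle]
      constructor <;> intro h
      · exact (Nat.even_add.mp he).mp h
      · exact (Nat.even_add.mp he).mpr h
    · show ((n - m : ℕ) : ℝ) ≤ (n : ℝ) + m
      rw [Nat.cast_sub hle]
      have : (0 : ℝ) ≤ m := Nat.cast_nonneg m
      linarith
    · show 0 ≤ (if m < n then vtxAlpha' s n * vtxAlpha' s m else vtxAlpha' s n ^ 2 / 2)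
      have h1 := vtxAlpha'_nonneg hs.le n
      have h2 := vtxAlpha'_nonneg hs.le m
      split_ifs <;> positivity
  · refine ⟨show Even (2 * (k - l)) from even_two_mul _, ?_, ?_⟩
    · show ((2 * (k - l) : ℕ) : ℝ) ≤ 4 * s + 2 * k + 2 * l
      push_cast
      rw [Nat.cast_sub hle]
      have : (0 : ℝ) ≤ l := Nat.cast_nonneg l
      linarith
    · show 0 ≤ (if l < k then vtxGamma k s * vtxGamma l s / 2 else vtxGamma k s ^ 2 / 4)
      have h1 := (vtxGamma_pos k hs).le
      have h2 := (vtxGamma_pos l hs).le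
      split_ifs <;> positivity

/-- **Crossing of the witness**: the free boson solves the `⟨OOOO⟩` sum rule at `Δ_O = s` (`s > 0`) in the
tree's conventions: `v^s (𝒢-1)(z,z̄) - u^s (𝒢-1)(1-z,1-z̄) = u^s - v^s = -F_-[1]`.
[cite: RattazziEtAl2008, §3 eq. (3.6)] -/
theorem vertexData2D_satisfiesCrossing (hs : 0 < s) : (vertexData2D s).SatisfiesCrossing s := by
  intro z zb hz hzb
  have hz' : 1 - z ∈ Ioo (0 : ℝ) 1 := ⟨by linarith [hz.2], by linarith [hz.1]⟩
  have hzb' : 1 - zb ∈ Ioo (0 : ℝ) 1 := ⟨by linarith [hzb.2], by linarith [hzb.1]⟩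
  have A := (hasSum_vertexData2D_blocks hs hz hzb).mul_left (((1 - z) * (1 - zb)) ^ s)
  have B := (hasSum_vertexData2D_blocks hs hz' hzb').mul_left ((-1) * (z * zb) ^ s)
  have AB := A.add B
  -- the scalar identity behind crossing, in the variables a = (1-z)^s, b = (1-zb)^s, c = z^s, d = zb^s
  have ha : 0 < (1 - z) ^ s := Real.rpow_pos_of_pos hz'.1 s
  have hb : 0 < (1 - zb) ^ s := Real.rpow_pos_of_pos hzb'.1 s
  have hc : 0 < z ^ s := Real.rpow_pos_of_pos hz.1 s
  have hd : 0 < zb ^ s := Real.rpow_pos_of_pos hzb.1 s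
  have e1 : ((1 - z) * (1 - zb)) ^ s = (1 - z) ^ s * (1 - zb) ^ s := Real.mul_rpow hz'.1.le hzb'.1.le
  have e2 : (z * zb) ^ s = z ^ s * zb ^ s := Real.mul_rpow hz.1.le hzb.1.le
  have e3 : (1 - z) ^ (-s) = ((1 - z) ^ s)⁻¹ := Real.rpow_neg hz'.1.le s
  have e4 : (1 - zb) ^ (-s) = ((1 - zb) ^ s)⁻¹ := Real.rpow_neg hzb'.1.le s
  have e5 : z ^ (2 * s) = (z ^ s) ^ 2 := by rw [mul_comm, Real.rpow_mul hz.1.le]; norm_num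
  have e6 : zb ^ (2 * s) = (zb ^ s) ^ 2 := by rw [mul_comm, Real.rpow_mul hzb.1.le]; norm_num
  have e7 : (1 - z) ^ (2 * s) = ((1 - z) ^ s) ^ 2 := by rw [mul_comm, Real.rpow_mul hz'.1.le]; norm_num
  have e8 : (1 - zb) ^ (2 * s) = ((1 - zb) ^ s) ^ 2 := by rw [mul_comm, Real.rpow_mul hzb'.1.le]; norm_num
  have e9 : (1 - (1 - z)) = z := by ring
  have e10 : (1 - (1 - zb)) = zb := by ring
  have e11 : z ^ (-s) = (z ^ s)⁻¹ := Real.rpow_neg hz.1.le s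
  have e12 : zb ^ (-s) = (zb ^ s)⁻¹ := Real.rpow_neg hzb.1.le s
  have hval : ((1 - z) * (1 - zb)) ^ s *
        ((((1 - z) ^ (-s) * (1 - zb) ^ (-s) + (1 - z) ^ s * (1 - zb) ^ s) / 2 - 1) +
          (z ^ (2 * s) / (1 - z) ^ s) * (zb ^ (2 * s) / (1 - zb) ^ s) / 2) +
      (-1) * (z * zb) ^ s *
        ((((1 - (1 - z)) ^ (-s) * (1 - (1 - zb)) ^ (-s) + (1 - (1 - z)) ^ s * (1 - (1 - zb)) ^ s) / 2 - 1) +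
          ((1 - z) ^ (2 * s) / (1 - (1 - z)) ^ s) * ((1 - zb) ^ (2 * s) / (1 - (1 - zb)) ^ s) / 2) =
      -(crossF s (-1) (fun _ _ => (1 : ℝ)) z zb) := by
    simp only [crossF, e9, e10]
    rw [e1, e2, e3, e4, e5, e6, e7, e8, e11, e12]
    field_simp
    ring
  rw [← hval]
  refine AB.congr_fun fun i => ?_
  simp only [crossF]
  ring

/-! ### The spectrum of the witness -/

/-- **Scalars** of the witness: `Δ ∈ {4s} ∪ [2, ∞)` (identity family `2n`, `n ≥ 1`; charge family `4s + 4k`).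
[folklore] -/
theorem vertexData2D_scalarsIn (hs : 0 < s) : (vertexData2D s).ScalarsIn ({4 * s} ∪ Ici 2) := by
  rintro (⟨⟨n, m⟩, hle, he, hne⟩ | ⟨⟨k, l⟩, hle⟩) hi
  · have h0 : n - m = 0 := hi
    have hnm : n = m := by omega
    subst hnm
    have hn : 1 ≤ n := by
      by_contra h; apply hne; simp only [Prod.mk.injEq]; omega
    right
    show (2 : ℝ) ≤ (n : ℝ) + n
    have : (1 : ℝ) ≤ n := by exact_mod_cast hn
    linarith
  · have h0 : 2 * (k - l) = 0 := hi
    have hkl : k = l := by omega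
    subst hkl
    rcases Nat.eq_zero_or_pos k with hk | hk
    · subst hk; left; show 4 * s + 2 * ((0 : ℕ) : ℝ) + 2 * ((0 : ℕ) : ℝ) = 4 * s; simp
    · right
      show (2 : ℝ) ≤ 4 * s + 2 * k + 2 * k
      have : (1 : ℝ) ≤ k := by exact_mod_cast hk
      linarith

/-- **Scalar gap** of the witness: `min(4s, 2)`. [folklore] -/
theorem vertexData2D_hasScalarGap (hs : 0 < s) : (vertexData2D s).HasScalarGap (min (4 * s) 2) := by
  intro i hi
  rcases vertexData2D_scalarsIn hs i hi with h | h
  · rw [Set.mem_singleton_iff] at h; rw [h]; exact min_le_left _ _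
  · exact (min_le_right _ _).trans h

/-- **Spin-2 content** of the witness: `Δ ∈ {2} ∪ [2 + min(2, 4s), ∞)` — the stress tensor `(2,0)`, the
identity family `2m+2 ≥ 4`, the charge family `4s + 4l + 2 ≥ 4s + 2`. [folklore] -/
theorem vertexData2D_spinTwoIn (s : ℝ) :
    (vertexData2D s).SpinTwoIn ({2} ∪ Ici (2 + min 2 (4 * s))) := by
  rintro (⟨⟨n, m⟩, hle, he, hne⟩ | ⟨⟨k, l⟩, hle⟩) hi
  · have h2 : n - m = 2 := hi
    have hn : n = m + 2 := by omega
    subst hn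
    rcases Nat.eq_zero_or_pos m with hm | hm
    · subst hm; left; show (((0 + 2 : ℕ) : ℝ) + ((0 : ℕ) : ℝ)) = 2; norm_num
    · right
      show 2 + min 2 (4 * s) ≤ (((m + 2 : ℕ) : ℝ) + m)
      push_cast
      have : (1 : ℝ) ≤ m := by exact_mod_cast hm
      linarith [min_le_left (2 : ℝ) (4 * s)]
  · have h2 : 2 * (k - l) = 2 := hi
    have hk : k = l + 1 := by omega
    subst hk
    right
    show 2 + min 2 (4 * s) ≤ 4 * s + 2 * ((l + 1 : ℕ) : ℝ) + 2 * l
    push_cast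
    have : (0 : ℝ) ≤ l := Nat.cast_nonneg l
    linarith [min_le_right (2 : ℝ) (4 * s)]

/-- The stress-tensor label `(2, 0)` of the identity family. [folklore] -/
def vtxStressLabel : VtxIdLabel := ⟨(2, 0), by decide, ⟨1, rfl⟩, by decide⟩

/-- The stress-tensor label carries `(Δ, ℓ, p) = (2, 2, s²/2)`. [folklore] -/
theorem vertexData2D_stressLabel (s : ℝ) :
    (vertexData2D s).Δ (Sum.inl vtxStressLabel) = 2 ∧ (vertexData2D s).spin (Sum.inl vtxStressLabel) = 2 ∧
      (vertexData2D s).p (Sum.inl vtxStressLabel) = s ^ 2 / 2 := by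
  refine ⟨by show ((2 : ℕ) : ℝ) + ((0 : ℕ) : ℝ) = 2; norm_num, rfl, ?_⟩
  show (if 0 < 2 then vtxAlpha' s 2 * vtxAlpha' s 0 else vtxAlpha' s 2 ^ 2 / 2) = s ^ 2 / 2
  simp [vtxAlpha', (vtxAlpha_values s).2.2]

/-- The stress-tensor label lies in the `(2,2)` set. [folklore] -/
theorem vertexData2D_stress_mem (s : ℝ) :
    (Sum.inl vtxStressLabel : (vertexData2D s).ι) ∈ (vertexData2D s).stressSet :=
  ⟨(vertexData2D_stressLabel s).1, (vertexData2D_stressLabel s).2.1⟩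

/-- Every other label is off the `(2,2)` location (for `s > 0`), so the `(2,2)` indicator of `p` vanishes
there. [folklore] -/
theorem vertexData2D_stress_indicator_of_ne (hs : 0 < s) (i : (vertexData2D s).ι)
    (hi : i ≠ Sum.inl vtxStressLabel) : (vertexData2D s).stressSet.indicator (vertexData2D s).p i = 0 := by
  refine Set.indicator_of_notMem ?_ _
  rintro ⟨hΔ, hsp⟩
  rcases i with ⟨⟨n, m⟩, hle, he, hne⟩ | ⟨⟨k, l⟩, hle⟩
  · have hsp' : n - m = 2 := hsp
    have hΔ' : (n : ℝ) + m = 2 := hΔ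
    obtain rfl : n = m + 2 := by omega
    have hm : m = 0 := by
      push_cast at hΔ'
      have : (m : ℝ) = 0 := by linarith
      exact_mod_cast this
    subst hm
    exact hi rfl
  · have hsp' : 2 * (k - l) = 2 := hsp
    have hΔ' : 4 * s + 2 * (k : ℝ) + 2 * l = 2 := hΔ
    obtain rfl : k = l + 1 := by omega
    push_cast at hΔ'
    have : (0 : ℝ) ≤ l := Nat.cast_nonneg l
    linarith

/-- **The total `(2,2)` coefficient of the witness is the Ward value at `c = 1`:
`stressCoeff = s²/2 = Δ_O²/(2c)`**, in the normalisation `g_T = k_4(z) + k_4(z̄)` of `Control2DBootstrap` —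
the hypothesis `CTwoSided` takes, realised by a datum. [cite: BelavinPolyakovZamolodchikov1984, §3] -/
theorem vertexData2D_stressCoeff (hs : 0 < s) : (vertexData2D s).stressCoeff = s ^ 2 / 2 := by
  unfold CrossingData.stressCoeff
  have key : ∀ i : (vertexData2D s).ι, i ≠ Sum.inl vtxStressLabel →
      (vertexData2D s).stressSet.indicator (vertexData2D s).p i = 0 :=
    fun i hi => vertexData2D_stress_indicator_of_ne hs i hi
  rw [tsum_eq_single _ key]
  exact (Set.indicator_of_mem (vertexData2D_stress_mem s) _).trans (vertexData2D_stressLabel s).2.2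

end Data

end Summit.CriticalPhenomena.Ising3D.Control2D
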